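import Mathlib
import Summits.CriticalPhenomena.PercolationContinuityZ3.Theorems.PercNearOneGluingNoHeavyLowerTailHypergeomReciprocalCM
import HarnessLib

/-!
# LEMMA P: products `∏_{m≤r} τ_m` with `1 - τ` completely monotone are Hausdorff moment sequences; the scaling lemma; `σ` CM ⟹ TN

Support file for the Sahi / Conjecture-P programme of route `PercNearOneGluingNoHeavy`
(`--supports stmt-CriticalPhenomena-4575`, prover prim-l12-p5 gen 36; proof note
`prim-l12-p5/PROOF-THEOREM-H-g36.md` §6′).  No definitions, no named facts, no sorries.

Hausdorff differences `D_k h (j) = Σ_{i≤k} (-1)^i C(k,i) h(j+i)` are written out; sequences indexed by `m ≥ 1` are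
passed as `m ↦ h (m+1)`.  Results:

* **LEMMA P** (`altSum_prod_nonneg`, strict form `altSum_prod_pos`): if `0 < τ_m` (`m ≥ 1`) and `m ↦ 1 - τ_m` is
  completely monotone, then `μ_r := ∏_{m≤r} τ_m` is completely monotone — strictly if all `τ_m < 1`.  Proof:
  `μ_r - μ_{r+1} = μ_r (1 - τ_{r+1})` and the truncated Leibniz rule (memo §6′).  With THEOREM W♯(⟸) this PROVES
  the criterion observed numerically in g35: `σ_n = c_n/(n+c_n)` CM ⟹ `[(l+c_n)/(n-l)!]` TN
  (`lPlusC_div_factorial_tn_of_sigma`).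
* `altSum_mul_pos_of_pos_upto`, `altSum_inv_pos` — truncated strict Leibniz and the strict LEMMA DB: `f > 0` strictly
  increasing with CM first difference ⟹ `1/f` strictly CM.
* **SCALING LEMMA** (`altSum_prod_scaling_pos`): if `a_m > 0` has completely monotone first difference ("discrete
  Bernstein odds") then for EVERY `λ > 0`, `r ↦ ∏_{m≤r} a_m/(a_m+λ)` is strictly completely monotone; hence
  (`lPlusC_div_factorial_tn_of_odds`) if the odds `n/c_n` of `c > 0` are discrete Bernstein then
  `[(l + λ c_n)/(n-l)!]` is totally nonnegative for every `λ > 0` (CBF `c` is the special case `x/c(x)` CBF).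
* `altSum_div_one_sub_nonneg` — `x_m < 1` CM and `0 ≤ s < 1` ⟹ `x_m/(1 - s x_m)` CM (the step behind THEOREM N⁺⁺,
  `q_A ≥ 1`, of the memo, whose remaining input "`x_m = 1 - e_{m-1}/e_m` is CM" is THEOREM X, proved analytically there).
-/

namespace Summit.CriticalPhenomena.PercolationContinuityZ3.Theorems

namespace MomentRatioTN

open Finset
open scoped Nat

/-! ### LEMMA P -/

/-- **LEMMA P.**  Let `τ : ℕ → ℝ` with `0 < τ (m+1)` and suppose `m ↦ 1 - τ (m+1)` is completely monotone.  Then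
`r ↦ ∏_{m<r} τ (m+1) = τ_1 ⋯ τ_r` is completely monotone. -/
theorem altSum_prod_nonneg (τ : ℕ → ℝ) (hτ : ∀ m, 0 < τ (m + 1))
    (hσ : ∀ k j, 0 ≤ ∑ i ∈ range (k + 1), (-1 : ℝ) ^ i * (k.choose i : ℝ) * (1 - τ (j + i + 1)))
    (k j : ℕ) : 0 ≤ ∑ i ∈ range (k + 1), (-1 : ℝ) ^ i * (k.choose i : ℝ) * ∏ m ∈ range (j + i), τ (m + 1) := by
  suffices hK : ∀ K, ∀ k ≤ K, ∀ j,
      0 ≤ ∑ i ∈ range (k + 1), (-1 : ℝ) ^ i * (k.choose i : ℝ) * ∏ m ∈ range (j + i), τ (m + 1) from hK k k le_rfl j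
  intro K
  induction K with
  | zero =>
    intro k hk j
    obtain rfl : k = 0 := Nat.le_zero.1 hk
    simpa using (prod_pos fun m _ => hτ m).le
  | succ K ih =>
    intro k hk j
    rcases Nat.lt_or_ge k (K + 1) with hlt | hge
    · exact ih k (by omega) j
    obtain rfl : k = K + 1 := le_antisymm hk hge
    have hs := altSum_succ (fun r => ∏ m ∈ range r, τ (m + 1)) K j
    rw [show K + 1 + 1 = K + 2 from rfl, hs]
    have key : ∀ r, ∏ m ∈ range r, τ (m + 1) - ∏ m ∈ range (r + 1), τ (m + 1) =
        (∏ m ∈ range r, τ (m + 1)) * (1 - τ (r + 1)) := by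
      intro r
      rw [prod_range_succ]
      ring
    simp_rw [key]
    exact altSum_mul_nonneg_upto (fun r => ∏ m ∈ range r, τ (m + 1)) (fun r => 1 - τ (r + 1)) K ih
      (fun k' _ j' => hσ k' j') K le_rfl j

/-- **LEMMA P, strict form.**  If moreover `τ (m+1) < 1` for all `m`, the product sequence is STRICTLY completely
monotone. -/
theorem altSum_prod_pos (τ : ℕ → ℝ) (hτ : ∀ m, 0 < τ (m + 1)) (hτ1 : ∀ m, τ (m + 1) < 1)
    (hσ : ∀ k j, 0 ≤ ∑ i ∈ range (k + 1), (-1 : ℝ) ^ i * (k.choose i : ℝ) * (1 - τ (j + i + 1)))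
    (k j : ℕ) : 0 < ∑ i ∈ range (k + 1), (-1 : ℝ) ^ i * (k.choose i : ℝ) * ∏ m ∈ range (j + i), τ (m + 1) := by
  induction k generalizing j with
  | zero => simpa using prod_pos fun m _ => hτ m
  | succ K ih =>
    have hs := altSum_succ (fun r => ∏ m ∈ range r, τ (m + 1)) K j
    rw [show K + 1 + 1 = K + 2 from rfl, hs]
    have key : ∀ r, ∏ m ∈ range r, τ (m + 1) - ∏ m ∈ range (r + 1), τ (m + 1) =
        (∏ m ∈ range r, τ (m + 1)) * (1 - τ (r + 1)) := by
      intro r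
      rw [prod_range_succ]
      ring
    simp_rw [key]
    rw [altSum_mul (fun r => ∏ m ∈ range r, τ (m + 1)) (fun r => 1 - τ (r + 1)) K j, sum_range_succ]
    refine add_pos_of_nonneg_of_pos (sum_nonneg fun i hi => ?_) ?_
    · rw [mem_range] at hi
      exact mul_nonneg (by positivity) (mul_nonneg (altSum_prod_nonneg τ hτ hσ i j) (hσ (K - i) (j + i)))
    · rw [Nat.choose_self, Nat.cast_one, one_mul, Nat.sub_self]
      have h0 : ∑ b ∈ range (0 + 1), (-1 : ℝ) ^ b * ((0 : ℕ).choose b : ℝ) * (1 - τ (j + K + b + 1)) =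
          1 - τ (j + K + 1) := by simp
      rw [h0]
      exact mul_pos (ih j) (by linarith [hτ1 (j + K)])

/-- **σ CM ⟹ TN** (g35's observed criterion, now a theorem): if `c_n > 0` and `σ_n := c_n/(n + c_n)` is completely
monotone on `n ≥ 1`, then `[(l + c_n)/(n-l)!]_{l ≤ n}` is totally nonnegative. -/
theorem lPlusC_div_factorial_tn_of_sigma (c : ℕ → ℝ) (hc : ∀ n, 0 < c n)
    (hσ : ∀ k j, 0 ≤ ∑ i ∈ range (k + 1), (-1 : ℝ) ^ i * (k.choose i : ℝ) *
      (c (j + i + 1) / (((j + i + 1 : ℕ) : ℝ) + c (j + i + 1))))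
    {k : ℕ} (r c' : Fin k → ℕ) (hr : StrictMono r) (hc' : StrictMono c') :
    0 ≤ (Matrix.of fun i j =>
      if c' j ≤ r i then ((c' j : ℝ) + c (r i)) / ((r i - c' j)! : ℕ) else 0).det := by
  refine lPlusC_div_factorial_tn c hc (fun k j => ?_) r c' hr hc'
  have hμ : ∀ r : ℕ, ((r ! : ℕ) : ℝ) / ∏ m ∈ range r, ((m : ℝ) + 1 + c (m + 1)) =
      ∏ m ∈ range r, (((m + 1 : ℕ) : ℝ) / (((m + 1 : ℕ) : ℝ) + c (m + 1))) := by
    intro r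
    rw [prod_div_distrib, ← Nat.cast_prod, Finset.prod_range_add_one_eq_factorial]
    push_cast
    rfl
  simp only [hμ]
  refine altSum_prod_pos (fun n => (n : ℝ) / ((n : ℝ) + c n)) (fun m => ?_) (fun m => ?_) (fun k j => ?_) k j
  · have := hc (m + 1); positivity
  · have := hc (m + 1)
    rw [div_lt_one (by positivity)]
    linarith
  · have e : ∀ n : ℕ, (1 : ℝ) - ((n + 1 : ℕ) : ℝ) / (((n + 1 : ℕ) : ℝ) + c (n + 1)) =
        c (n + 1) / (((n + 1 : ℕ) : ℝ) + c (n + 1)) := by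
      intro n
      have := hc (n + 1)
      field_simp
      ring
    have hsum : (∑ i ∈ range (k + 1), (-1 : ℝ) ^ i * (k.choose i : ℝ) *
        (1 - (fun n : ℕ => (n : ℝ) / ((n : ℝ) + c n)) (j + i + 1))) =
        ∑ i ∈ range (k + 1), (-1 : ℝ) ^ i * (k.choose i : ℝ) *
          (c (j + i + 1) / (((j + i + 1 : ℕ) : ℝ) + c (j + i + 1))) :=
      sum_congr rfl fun i _ => by rw [← e (j + i)]
    rw [hsum]
    exact hσ k j

/-! ### Strict LEMMA DB and the scaling lemma -/

/-- Truncated strict Leibniz: `f > 0` pointwise with `D_i f ≥ 0` (`i ≤ K`) and `D_i g > 0` (`i ≤ K`) give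
`D_K (fg) > 0`. -/
theorem altSum_mul_pos_of_pos_upto (f g : ℕ → ℝ) (K : ℕ) (hf0 : ∀ r, 0 < f r)
    (hf : ∀ k ≤ K, ∀ j, 0 ≤ ∑ i ∈ range (k + 1), (-1 : ℝ) ^ i * (k.choose i : ℝ) * f (j + i))
    (hg : ∀ k ≤ K, ∀ j, 0 < ∑ i ∈ range (k + 1), (-1 : ℝ) ^ i * (k.choose i : ℝ) * g (j + i)) (j : ℕ) :
    0 < ∑ i ∈ range (K + 1), (-1 : ℝ) ^ i * (K.choose i : ℝ) * (f (j + i) * g (j + i)) := by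
  rw [altSum_mul, sum_range_succ']
  refine add_pos_of_nonneg_of_pos (sum_nonneg fun i hi => ?_) ?_
  · rw [mem_range] at hi
    exact mul_nonneg (by positivity)
      (mul_nonneg (hf (i + 1) (by omega) j) (hg (K - (i + 1)) (by omega) (j + (i + 1))).le)
  · have h0 : ∑ a ∈ range (0 + 1), (-1 : ℝ) ^ a * ((0 : ℕ).choose a : ℝ) * f (j + a) = f j := by simp
    rw [h0, Nat.choose_zero_right, Nat.cast_one, one_mul, Nat.sub_zero]
    simpa using mul_pos (hf0 j) (hg K le_rfl j)

/-- **LEMMA DB, strict form.**  If `f > 0` is strictly increasing with completely monotone first difference, then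
`1/f` is STRICTLY completely monotone. -/
theorem altSum_inv_pos (f : ℕ → ℝ) (hf : ∀ r, 0 < f r) (hinc : ∀ r, f r < f (r + 1))
    (hΔ : ∀ k j, 0 ≤ ∑ i ∈ range (k + 1), (-1 : ℝ) ^ i * (k.choose i : ℝ) * (f (j + i + 1) - f (j + i)))
    (k j : ℕ) : 0 < ∑ i ∈ range (k + 1), (-1 : ℝ) ^ i * (k.choose i : ℝ) * (f (j + i))⁻¹ := by
  suffices hK : ∀ K, ∀ k ≤ K, ∀ j, 0 < ∑ i ∈ range (k + 1), (-1 : ℝ) ^ i * (k.choose i : ℝ) * (f (j + i))⁻¹ from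
    hK k k le_rfl j
  intro K
  induction K with
  | zero =>
    intro k hk j
    obtain rfl : k = 0 := Nat.le_zero.1 hk
    simpa using hf j
  | succ K ih =>
    intro k hk j
    rcases Nat.lt_or_ge k (K + 1) with hlt | hge
    · exact ih k (by omega) j
    obtain rfl : k = K + 1 := le_antisymm hk hge
    have hs := altSum_succ (fun r => (f r)⁻¹) K j
    rw [show K + 1 + 1 = K + 2 from rfl, hs]
    have key : ∀ r, (f r)⁻¹ - (f (r + 1))⁻¹ = (f (r + 1) - f r) * ((f r)⁻¹ * (f (r + 1))⁻¹) := by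
      intro r
      have h1 := (hf r).ne'
      have h2 := (hf (r + 1)).ne'
      field_simp
    simp_rw [key]
    -- Δf > 0 with CM differences, times ((1/f)(1/f∘S)) which is strictly CM up to order K
    refine altSum_mul_pos_of_pos_upto (fun r => f (r + 1) - f r) (fun r => (f r)⁻¹ * (f (r + 1))⁻¹) K
      (fun r => by linarith [hinc r]) (fun k' _ j' => hΔ k' j') (fun k' hk' j' => ?_) j
    exact altSum_mul_pos_of_pos_upto (fun r => (f r)⁻¹) (fun r => (f (r + 1))⁻¹) k' (fun r => inv_pos.2 (hf r))
      (fun k'' _ j'' => altSum_inv_nonneg f hf hΔ k'' j'')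
      (fun k'' hk'' j'' => by
        rw [altSum_shift (fun r => (f r)⁻¹) k'' j'']
        exact ih k'' (by omega) (j'' + 1)) j'

/-- **SCALING LEMMA.**  If `a_m > 0` (`m ≥ 1`) has completely monotone first difference (passed as the sequence
`m ↦ a (m+1+1) - a (m+1)`), then for every `λ > 0` the products `∏_{m≤r} a_m/(a_m + λ)` form a strictly completely
monotone sequence. -/
theorem altSum_prod_scaling_pos (a : ℕ → ℝ) (ha : ∀ m, 0 < a (m + 1))
    (hΔ : ∀ k j, 0 ≤ ∑ i ∈ range (k + 1), (-1 : ℝ) ^ i * (k.choose i : ℝ) * (a (j + i + 1 + 1) - a (j + i + 1)))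
    (lam : ℝ) (hlam : 0 < lam) (k j : ℕ) :
    0 < ∑ i ∈ range (k + 1), (-1 : ℝ) ^ i * (k.choose i : ℝ) *
      ∏ m ∈ range (j + i), (a (m + 1) / (a (m + 1) + lam)) := by
  refine altSum_prod_pos (fun n => a n / (a n + lam)) (fun m => by have := ha m; positivity)
    (fun m => by have := ha m; rw [div_lt_one (by positivity)]; linarith) (fun k j => ?_) k j
  have e : ∀ n : ℕ, 1 - a (n + 1) / (a (n + 1) + lam) = lam * (a (n + 1) + lam)⁻¹ := by
    intro n
    have := ha n
    field_simp
    ring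
  have hsum : (∑ i ∈ range (k + 1), (-1 : ℝ) ^ i * (k.choose i : ℝ) *
      (1 - (fun n : ℕ => a n / (a n + lam)) (j + i + 1))) =
      ∑ i ∈ range (k + 1), (-1 : ℝ) ^ i * (k.choose i : ℝ) * (lam * (a (j + i + 1) + lam)⁻¹) :=
    sum_congr rfl fun i _ => by rw [← e (j + i)]
  rw [hsum, HypergeomCM.altSum_const_mul lam (fun n => (a (n + 1) + lam)⁻¹) k j]
  refine mul_nonneg hlam.le (altSum_inv_nonneg (fun n => a (n + 1) + lam) (fun n => by have := ha n; positivity)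
    (fun k' j' => ?_) k j)
  have hsum' : (∑ i ∈ range (k' + 1), (-1 : ℝ) ^ i * (k'.choose i : ℝ) *
      ((fun n : ℕ => a (n + 1) + lam) (j' + i + 1) - (fun n : ℕ => a (n + 1) + lam) (j' + i))) =
      ∑ i ∈ range (k' + 1), (-1 : ℝ) ^ i * (k'.choose i : ℝ) * (a (j' + i + 1 + 1) - a (j' + i + 1)) :=
    sum_congr rfl fun i _ => by ring
  rw [hsum']
  exact hΔ k' j'

/-- **Odds discrete Bernstein ⟹ the whole ray is TN.**  If `c_n > 0` and the odds `a_n := n/c_n` (`n ≥ 1`) have completely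
monotone first difference, then for every `λ > 0` the kernel `[(l + λ c_n)/(n-l)!]_{l ≤ n}` is totally nonnegative. -/
theorem lPlusC_div_factorial_tn_of_odds (c : ℕ → ℝ) (hc : ∀ n, 0 < c n)
    (hΔ : ∀ k j, 0 ≤ ∑ i ∈ range (k + 1), (-1 : ℝ) ^ i * (k.choose i : ℝ) *
      ((((j + i + 1 + 1 : ℕ) : ℝ)) / c (j + i + 1 + 1) - (((j + i + 1 : ℕ) : ℝ)) / c (j + i + 1)))
    (lam : ℝ) (hlam : 0 < lam) {k : ℕ} (r c' : Fin k → ℕ) (hr : StrictMono r) (hc' : StrictMono c') :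
    0 ≤ (Matrix.of fun i j =>
      if c' j ≤ r i then ((c' j : ℝ) + lam * c (r i)) / ((r i - c' j)! : ℕ) else 0).det := by
  refine lPlusC_div_factorial_tn (fun n => lam * c n) (fun n => mul_pos hlam (hc n)) (fun k j => ?_) r c' hr hc'
  -- r!/∏(m+1+λ c_{m+1}) = ∏ a_{m+1}/(a_{m+1}+λ) with a_n = n/c_n
  have hμ : ∀ r : ℕ, ((r ! : ℕ) : ℝ) / ∏ m ∈ range r, ((m : ℝ) + 1 + (fun n => lam * c n) (m + 1)) =
      ∏ m ∈ range r, ((((m + 1 : ℕ) : ℝ) / c (m + 1)) / ((((m + 1 : ℕ) : ℝ) / c (m + 1)) + lam)) := by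
    intro r
    rw [← Finset.prod_range_add_one_eq_factorial, Nat.cast_prod, ← prod_div_distrib]
    refine prod_congr rfl fun m _ => ?_
    have := hc (m + 1)
    push_cast
    field_simp
  simp only [hμ]
  exact altSum_prod_scaling_pos (fun n => (n : ℝ) / c n) (fun m => by have := hc (m + 1); positivity)
    (fun k j => by simpa using hΔ k j) lam hlam k j

/-! ### The `x/(1 - s x)` step of THEOREM N⁺⁺ -/

/-- If `x_m < 1` is completely monotone (so `0 ≤ x_m < 1`) and `0 ≤ s < 1`, then `x_m/(1 - s x_m)` is completely monotone
(`1 - s x` is a positive discrete Bernstein sequence, so `1/(1 - s x)` is CM by LEMMA DB; then Leibniz). -/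
theorem altSum_div_one_sub_nonneg (x : ℕ → ℝ) (hx1 : ∀ m, x m < 1)
    (hx : ∀ k j, 0 ≤ ∑ i ∈ range (k + 1), (-1 : ℝ) ^ i * (k.choose i : ℝ) * x (j + i))
    (s : ℝ) (hs0 : 0 ≤ s) (hs1 : s < 1) (k j : ℕ) :
    0 ≤ ∑ i ∈ range (k + 1), (-1 : ℝ) ^ i * (k.choose i : ℝ) * (x (j + i) / (1 - s * x (j + i))) := by
  have hpos : ∀ m, 0 < 1 - s * x m := fun m => by nlinarith [hx1 m]
  simp_rw [div_eq_mul_inv]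
  refine altSum_mul_nonneg x (fun m => (1 - s * x m)⁻¹) hx (fun k' j' => ?_) k j
  refine altSum_inv_nonneg (fun m => 1 - s * x m) hpos (fun k'' j'' => ?_) k' j'
  -- Δ(1 - s x)(m) = s (x m - x (m+1)), and D_k of (x - x∘S) is D_{k+1} x ≥ 0
  have e : ∀ m, (1 - s * x (m + 1)) - (1 - s * x m) = s * (x m - x (m + 1)) := fun m => by ring
  simp_rw [e]
  rw [HypergeomCM.altSum_const_mul s (fun m => x m - x (m + 1)) k'' j'']
  refine mul_nonneg hs0 ?_
  rw [← altSum_succ x k'' j'']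
  exact hx (k'' + 1) j''

end MomentRatioTN

end Summit.CriticalPhenomena.PercolationContinuityZ3.Theorems
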